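import Mathlib
import HarnessLib
import Literature.Geometry.Lorentzian.ReggeWheelerTortoise
import Literature.Geometry.Lorentzian.ReggeWheelerChannels
import Summits.FinalStateConjecture.FinalStateConjecture.Theses.PhotonSphereChannels
import Summits.FinalStateConjecture.FinalStateConjecture.Theorems.PhotonSphereChannelsExteriorEnergyRW

/-!
# Sketch — crux `WindowedShellChannels` (stmt-FinalStateConjecture-14085), ideator 3, round 1

First lemmas / transfer statements of the two idea cards of this seat, stated over the landed
vocabulary `Literature.Geometry.Lorentzian.ReggeWheeler.*` and the route decl
`Theses.PhotonSphereChannels.WindowedShellChannels` (W).  `lean check` rc 0, 0 sorries; axioms of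
`parityTransfer_holds`: propext, Classical.choice, Quot.sound.

* card `parity-split-standing-start`: `evenPart`, `oddPart`, `ParitySplitIdentity` (first lemma —
  PROVED: `paritySplitIdentity_holds`), `WindowedShellChannelsEven`, `WindowedShellChannelsOdd`,
  `ParityTransfer` (the transfer `W ↔ W_even ∧ W_odd` — PROVED: `parityTransfer_holds`, from
  `parityTransfer_mp` = `windowed_imp_even` ∧ `windowed_imp_odd` and `parityTransfer_mpr`),
  `LagUpperSet` / `exteriorEnergy_mono_aperture` / `channelEnergy_mono_aperture` (aperture
  monotonicity).  By-products usable by every line on W: `tendsto_exteriorEnergy_atTop/atBot`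
  (exterior energies of a solution CONVERGE to the channel energies for EVERY aperture, lagged
  apertures `ρ − h < 0` included — via the time shift `tshift` and `RW.exteriorEnergy_antitoneOn`),
  `channel_parity_split` (`ch⁺(ψ) + ch⁻(ψ) = 2ch⁺(ψ_e) + 2ch⁺(ψ_o)`), `isSolution_evenPart/oddPart/
  tshift/treflect`, `totalEnergy_zero_split`.
* card `outward-completion-duality`: `completion_duality` (abstract Hilbert-space reduction — PROVED:
  positive contraction `K`, isometry `J`, completion `C` with `J† C = id` and `⟪(1−K)Cx,Cx⟫ ≤ θ²‖x‖²`
  ⇒ `(1−θ)²‖x‖² ≤ ‖C‖² ⟪K Jx, Jx⟫`), `OutwardDataEscapeEven` (the concrete analytic target).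
* card `invisible-limit-compactness`: `RayCensus` (first lemma: two-sided escape of every
  photon-sphere bicharacteristic that starts off the shell, with a uniform lag; numerically checked
  in `calc/raycensus*.py`), `FixedModeWindowedChannels` (the per-mode rung; `fixedMode_of_windowed`).
-/

noncomputable section

set_option linter.dupNamespace false

namespace Summit.FinalStateConjecture.FinalStateConjecture.Cruxes.WindowedShellChannels.Ideator3

open Literature.Geometry.Lorentzian Literature.Geometry.Lorentzian.ReggeWheeler
open Summit.FinalStateConjecture.FinalStateConjecture.Theses.PhotonSphereChannels
open Filter Set MeasureTheory
open scoped ENNReal Topology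

/-! ## Card `parity-split-standing-start` -/

/-- Even-in-time (standing-start) part of `ψ`: data `(ψ(0,·), 0)`. -/
def evenPart (ψ : ℝ → ℝ → ℝ) : ℝ → ℝ → ℝ := fun t x => (ψ t x + ψ (-t) x) / 2

/-- Odd-in-time (pure-kick) part of `ψ`: data `(0, ψ_t(0,·))`. -/
def oddPart (ψ : ℝ → ℝ → ℝ) : ℝ → ℝ → ℝ := fun t x => (ψ t x - ψ (-t) x) / 2

/-- FIRST LEMMA (parity split of the two-ended exterior energy, pointwise in `t`): time reversal
maps the exterior energy at `−t` to that at `t`, and the parallelogram law for the quadratic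
energy density splits `E_ext(t) + E_ext(−t)` into the even and odd parts — for every
nonnegative potential, every aperture (lagged apertures `ρ − h < 0` included) and every `C²`
function (no equation needed). -/
def ParitySplitIdentity : Prop :=
  ∀ (V : ℝ → ℝ), Continuous V → (∀ x, 0 ≤ V x) → ∀ (xc ρ : ℝ) (ψ : ℝ → ℝ → ℝ),
    ContDiff ℝ 2 (Function.uncurry ψ) → ∀ t : ℝ,
      exteriorEnergy V xc ρ ψ t + exteriorEnergy V xc ρ ψ (-t) =
        2 * exteriorEnergy V xc ρ (evenPart ψ) t + 2 * exteriorEnergy V xc ρ (oddPart ψ) t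

/-- `W_even`: ONE-ended (forward) windowed channels for STANDING-START Regge–Wheeler data
supported off the shell (`ψ(−t, x) = ψ(t, x)`, i.e. `ψ_t(0, ·) = 0`). -/
def WindowedShellChannelsEven : Prop :=
  ∀ M : ℝ, 0 < M → ∀ ρ : ℝ, 0 < ρ → ∃ h : ℝ, 0 ≤ h ∧ ∃ c : ℝ, 0 < c ∧ ∀ (r : ℝ → ℝ) (xc : ℝ),
    IsTortoiseRadius M r xc → ∀ (s ℓ : ℕ), s ≤ 2 → s ≤ ℓ → ∀ ψ : ℝ → ℝ → ℝ,
      IsRWSolution M s ℓ r ψ → (∀ t x, ψ (-t) x = ψ t x) →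
      CauchyDataSupportedOn ψ {x : ℝ | ρ < |x - xc|} →
        ENNReal.ofReal c * totalEnergy (linePotential M s ℓ r) ψ 0 ≤
          channelEnergy (linePotential M s ℓ r) xc (ρ - h) ψ atTop

/-- `W_odd`: ONE-ended (forward) windowed channels for PURE-KICK Regge–Wheeler data supported
off the shell (`ψ(−t, x) = −ψ(t, x)`, i.e. `ψ(0, ·) = 0`; the charged energy is then the bare
`L²` norm of the kick). -/
def WindowedShellChannelsOdd : Prop :=
  ∀ M : ℝ, 0 < M → ∀ ρ : ℝ, 0 < ρ → ∃ h : ℝ, 0 ≤ h ∧ ∃ c : ℝ, 0 < c ∧ ∀ (r : ℝ → ℝ) (xc : ℝ),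
    IsTortoiseRadius M r xc → ∀ (s ℓ : ℕ), s ≤ 2 → s ≤ ℓ → ∀ ψ : ℝ → ℝ → ℝ,
      IsRWSolution M s ℓ r ψ → (∀ t x, ψ (-t) x = - ψ t x) →
      CauchyDataSupportedOn ψ {x : ℝ | ρ < |x - xc|} →
        ENNReal.ofReal c * totalEnergy (linePotential M s ℓ r) ψ 0 ≤
          channelEnergy (linePotential M s ℓ r) xc (ρ - h) ψ atTop

/-- TRANSFER `C⁺`: the two-ended crux is equivalent to the conjunction of the two one-ended
parity statements (constants: `c ↦ c/2`, `h ↦ max h`; uses `ParitySplitIdentity`, the landed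
monotonicity `RW.exteriorEnergy_antitoneOn_rw`, and that `evenPart`/`oddPart` of an RW solution
are RW solutions with data `(ψ₀, 0)` / `(0, ψ₁)`). -/
def ParityTransfer : Prop :=
  WindowedShellChannels ↔ (WindowedShellChannelsEven ∧ WindowedShellChannelsOdd)

/-- The lag is PINNED by turning (rest) data: if the one-ended even/odd statements hold at
`(M, ρ)` with some lag, they hold with every lag above the two edge periapsis lags — here
abstracted as: the set of admissible lags at fixed `(M, ρ, c)` is an upper set (monotonicity in
the aperture), so `h(M, ρ)` may be taken to be any number above its infimum `h⋆(M, ρ)`. -/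
def LagUpperSet : Prop :=
  ∀ (V : ℝ → ℝ) (xc ρ h h' : ℝ) (ψ : ℝ → ℝ → ℝ), h ≤ h' →
    channelEnergy V xc (ρ - h) ψ atTop ≤ channelEnergy V xc (ρ - h') ψ atTop

/-! ## Card `invisible-limit-compactness` -/

/-- FIRST LEMMA (two-sided ray census, uniform lag).  For the photon-sphere symbol
`p(x, ξ) = √(ξ² + f(x))`, `f = (1 − 2M/r)/r²` on the tortoise line (the `ℓ → ∞` shape of
`V_{s,ℓ}/ℓ(ℓ+1)`, single nondegenerate maximum at `x = xc`), every bicharacteristic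
`ẋ = ξ/p`, `ξ̇ = −f′(x)/(2p)` that starts off the closed shell `{|x − xc| < ρ}` stays ahead of
the LAGGED light cone `{|x − xc| > ρ − H + |t|}` either for all `t ≥ 0` or for all `t ≤ 0`, with
ONE lag `H = H(M, ρ)` (the only two-sided trapped bicharacteristic is the photon orbit
`x ≡ xc, ξ ≡ 0`; `H ≈ max(Λ_near(xc − ρ), Λ_far(xc + ρ))`, `→ κ⁻¹ ln 2 = 4M ln 2` deep on the
near side). -/
def RayCensus : Prop :=
  ∀ M : ℝ, 0 < M → ∀ ρ : ℝ, 0 < ρ → ∃ H : ℝ, 0 < H ∧ ∀ (r : ℝ → ℝ) (xc : ℝ),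
    IsTortoiseRadius M r xc →
      let f : ℝ → ℝ := fun x => (1 - 2 * M / r x) / r x ^ 2
      ∀ (x ξ : ℝ → ℝ),
        (∀ t, HasDerivAt x (ξ t / Real.sqrt (ξ t ^ 2 + f (x t))) t) →
        (∀ t, HasDerivAt ξ (-(deriv f (x t)) / (2 * Real.sqrt (ξ t ^ 2 + f (x t)))) t) →
        ρ ≤ |x 0 - xc| →
          (∀ t, 0 ≤ t → ρ - H + |t| < |x t - xc|) ∨ (∀ t, t ≤ 0 → ρ - H + |t| < |x t - xc|)

/-- The per-mode rung (`h`, `c` may depend on `s, ℓ`): proved FIRST by the same compactness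
lever (strong limits in the energy space + asymptotic completeness of the 1-D wave group with
potential `V_{s,ℓ}`), exactly as `FixedModeChannels` is the per-mode rung of K1R. -/
def FixedModeWindowedChannels : Prop :=
  ∀ M : ℝ, 0 < M → ∀ ρ : ℝ, 0 < ρ → ∀ (s ℓ : ℕ), s ≤ 2 → s ≤ ℓ → ∃ h : ℝ, 0 ≤ h ∧ ∃ c : ℝ, 0 < c ∧
    ∀ (r : ℝ → ℝ) (xc : ℝ), IsTortoiseRadius M r xc → ∀ ψ : ℝ → ℝ → ℝ,
      IsRWSolution M s ℓ r ψ → CauchyDataSupportedOn ψ {x : ℝ | ρ < |x - xc|} →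
        ENNReal.ofReal c * totalEnergy (linePotential M s ℓ r) ψ 0 ≤
          channelEnergy (linePotential M s ℓ r) xc (ρ - h) ψ atTop +
            channelEnergy (linePotential M s ℓ r) xc (ρ - h) ψ atBot

/-- `W` trivially gives the per-mode rung (sanity: the rung is a weakening). -/
theorem fixedMode_of_windowed (hW : WindowedShellChannels) : FixedModeWindowedChannels := by
  intro M hM ρ hρ s ℓ hs hsℓ
  obtain ⟨h, hh, c, hc, H⟩ := hW M hM ρ hρ
  exact ⟨h, hh, c, hc, fun r xc hr ψ hψ hsupp => H r xc hr s ℓ hs hsℓ ψ hψ hsupp⟩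

/-- Sanity: the aperture monotonicity behind `LagUpperSet` at the level of exterior energies. -/
theorem exteriorEnergy_mono_aperture (V : ℝ → ℝ) (xc ρ ρ' : ℝ) (ψ : ℝ → ℝ → ℝ) (t : ℝ)
    (hρ : ρ' ≤ ρ) : exteriorEnergy V xc ρ ψ t ≤ exteriorEnergy V xc ρ' ψ t := by
  unfold exteriorEnergy
  refine lintegral_mono_set ?_
  intro x hx
  simp only [mem_setOf_eq] at hx ⊢
  linarith


/-! ## Card `parity-split-standing-start`: the easy direction `W → W_even ∧ W_odd`, PROVED -/

/-- Time reversal: if the energy density of `ψ` is even in `t`, so is every exterior energy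
(the region `{a + |t| < |x − xc|}` is even in `t`). -/
theorem exteriorEnergy_neg_eq (V : ℝ → ℝ) (xc a : ℝ) (ψ : ℝ → ℝ → ℝ)
    (hsq : ∀ t x, energyDensity V ψ (-t) x = energyDensity V ψ t x) (t : ℝ) :
    exteriorEnergy V xc a ψ (-t) = exteriorEnergy V xc a ψ t := by
  unfold exteriorEnergy
  have hset : {x : ℝ | a + |(-t)| < |x - xc|} = {x : ℝ | a + |t| < |x - xc|} := by
    ext x; simp [abs_neg]
  rw [hset]
  exact lintegral_congr fun x => by rw [hsq t x]

/-- The energy density of an even-in-time function is even in time (no differentiability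
needed: `deriv_comp_neg` is unconditional). -/
theorem energyDensity_neg_of_even (V : ℝ → ℝ) (ψ : ℝ → ℝ → ℝ) (heven : ∀ t x, ψ (-t) x = ψ t x)
    (t x : ℝ) : energyDensity V ψ (-t) x = energyDensity V ψ t x := by
  unfold energyDensity
  have hfun : (fun τ => ψ τ x) = fun τ => ψ (-τ) x := funext fun τ => (heven τ x).symm
  have h1 : deriv (fun τ => ψ τ x) (-t) = -deriv (fun τ => ψ τ x) t := by
    conv_lhs => rw [hfun]
    rw [deriv_comp_neg (fun τ => ψ τ x) (-t)]
    simp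
  have h2 : ψ (-t) = ψ t := funext fun y => heven t y
  rw [h1, h2]
  ring

/-- The energy density of an odd-in-time function is even in time. -/
theorem energyDensity_neg_of_odd (V : ℝ → ℝ) (ψ : ℝ → ℝ → ℝ) (hodd : ∀ t x, ψ (-t) x = -ψ t x)
    (t x : ℝ) : energyDensity V ψ (-t) x = energyDensity V ψ t x := by
  unfold energyDensity
  have hfun : (fun τ => ψ τ x) = fun τ => -ψ (-τ) x := funext fun τ => by
    have := hodd τ x; linarith
  have h1 : deriv (fun τ => ψ τ x) (-t) = deriv (fun τ => ψ τ x) t := by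
    conv_lhs => rw [hfun]
    rw [deriv.fun_neg, deriv_comp_neg (fun τ => ψ τ x) (-t)]
    simp
  have h2 : ψ (-t) = fun y => -ψ t y := funext fun y => hodd t y
  have h3 : deriv (fun y => -ψ t y) x = -deriv (ψ t) x := deriv.fun_neg
  rw [h1, h2, h3]
  ring

/-- For time-symmetric energy densities the backward channel equals the forward channel. -/
theorem channelEnergy_atBot_eq_atTop (V : ℝ → ℝ) (xc a : ℝ) (ψ : ℝ → ℝ → ℝ)
    (hsq : ∀ t x, energyDensity V ψ (-t) x = energyDensity V ψ t x) :
    channelEnergy V xc a ψ atBot = channelEnergy V xc a ψ atTop := by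
  unfold channelEnergy
  have hcomp : exteriorEnergy V xc a ψ = (exteriorEnergy V xc a ψ) ∘ Neg.neg := by
    funext t
    simp only [Function.comp_apply]
    rw [exteriorEnergy_neg_eq V xc a ψ hsq]
  conv_lhs => rw [hcomp]
  rw [Filter.liminf_comp, Filter.map_neg_atBot]

/-- Halving a two-sided bound in `ℝ≥0∞`. -/
theorem half_of_two_sided {c : ℝ} {E X : ℝ≥0∞}
    (h : ENNReal.ofReal c * E ≤ X + X) : ENNReal.ofReal (c / 2) * E ≤ X := by
  have h2 : ENNReal.ofReal c = 2 * ENNReal.ofReal (c / 2) := by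
    rw [show (2 : ℝ≥0∞) = ENNReal.ofReal 2 by simp, ← ENNReal.ofReal_mul (by norm_num)]
    congr 1; ring
  rw [h2, mul_assoc, ← two_mul] at h
  exact (ENNReal.mul_le_mul_iff_right (by norm_num) (by simp)).1 h

/-- **`W → W_even`** (half of the easy direction of `ParityTransfer`), PROVED. -/
theorem windowed_imp_even (hW : WindowedShellChannels) : WindowedShellChannelsEven := by
  intro M hM ρ hρ
  obtain ⟨h, hh, c, hc, H⟩ := hW M hM ρ hρ
  refine ⟨h, hh, c / 2, by positivity, fun r xc hr s ℓ hs hsℓ ψ hψ heven hsupp => ?_⟩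
  have key := H r xc hr s ℓ hs hsℓ ψ hψ hsupp
  rw [channelEnergy_atBot_eq_atTop _ xc (ρ - h) ψ
    (energyDensity_neg_of_even _ ψ heven)] at key
  exact half_of_two_sided key

/-- **`W → W_odd`** (other half of the easy direction of `ParityTransfer`), PROVED. -/
theorem windowed_imp_odd (hW : WindowedShellChannels) : WindowedShellChannelsOdd := by
  intro M hM ρ hρ
  obtain ⟨h, hh, c, hc, H⟩ := hW M hM ρ hρ
  refine ⟨h, hh, c / 2, by positivity, fun r xc hr s ℓ hs hsℓ ψ hψ hodd hsupp => ?_⟩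
  have key := H r xc hr s ℓ hs hsℓ ψ hψ hsupp
  rw [channelEnergy_atBot_eq_atTop _ xc (ρ - h) ψ
    (energyDensity_neg_of_odd _ ψ hodd)] at key
  exact half_of_two_sided key

/-- Easy direction of the transfer, assembled. -/
theorem parityTransfer_mp (hW : WindowedShellChannels) :
    WindowedShellChannelsEven ∧ WindowedShellChannelsOdd :=
  ⟨windowed_imp_even hW, windowed_imp_odd hW⟩


/-! ## Card `parity-split-standing-start`: the identity `ParitySplitIdentity`, PROVED -/

section ParityCalculus

open Summit.FinalStateConjecture.FinalStateConjecture.Theorems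

variable {ψ : ℝ → ℝ → ℝ}

theorem contDiff_slice_fst (hψ : ContDiff ℝ 2 (Function.uncurry ψ)) (x : ℝ) :
    ContDiff ℝ 2 (fun τ => ψ τ x) :=
  hψ.comp (contDiff_id.prodMk contDiff_const)

theorem contDiff_slice_snd (hψ : ContDiff ℝ 2 (Function.uncurry ψ)) (t : ℝ) :
    ContDiff ℝ 2 (ψ t) :=
  hψ.comp (contDiff_const.prodMk contDiff_id)

theorem differentiable_slice_fst (hψ : ContDiff ℝ 2 (Function.uncurry ψ)) (x : ℝ) :
    Differentiable ℝ (fun τ => ψ τ x) :=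
  (contDiff_slice_fst hψ x).differentiable (by norm_num)

theorem differentiable_slice_snd (hψ : ContDiff ℝ 2 (Function.uncurry ψ)) (t : ℝ) :
    Differentiable ℝ (ψ t) :=
  (contDiff_slice_snd hψ t).differentiable (by norm_num)

/-- The time-reflected function `(t, x) ↦ ψ(−t, x)` is `C²`. -/
theorem contDiff_uncurry_reflect (hψ : ContDiff ℝ 2 (Function.uncurry ψ)) :
    ContDiff ℝ 2 (Function.uncurry fun t x => ψ (-t) x) :=
  hψ.comp (contDiff_fst.neg.prodMk contDiff_snd)

theorem contDiff_uncurry_evenPart (hψ : ContDiff ℝ 2 (Function.uncurry ψ)) :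
    ContDiff ℝ 2 (Function.uncurry (evenPart ψ)) := by
  unfold evenPart
  exact (hψ.add (contDiff_uncurry_reflect hψ)).div_const 2

theorem contDiff_uncurry_oddPart (hψ : ContDiff ℝ 2 (Function.uncurry ψ)) :
    ContDiff ℝ 2 (Function.uncurry (oddPart ψ)) := by
  unfold oddPart
  exact (hψ.sub (contDiff_uncurry_reflect hψ)).div_const 2

theorem differentiable_slice_fst_reflect (hψ : ContDiff ℝ 2 (Function.uncurry ψ)) (x : ℝ) :
    Differentiable ℝ (fun τ => ψ (-τ) x) :=
  (differentiable_slice_fst hψ x).comp differentiable_neg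

theorem deriv_evenPart_fst (hψ : ContDiff ℝ 2 (Function.uncurry ψ)) (t x : ℝ) :
    deriv (fun τ => evenPart ψ τ x) t
      = (deriv (fun τ => ψ τ x) t - deriv (fun τ => ψ τ x) (-t)) / 2 := by
  have hf := differentiable_slice_fst hψ x
  have hg := differentiable_slice_fst_reflect hψ x
  show deriv (fun τ => (ψ τ x + ψ (-τ) x) / 2) t = _
  rw [deriv_div_const, deriv_fun_add (hf t) (hg t), deriv_comp_neg (fun τ => ψ τ x) t]
  ring

theorem deriv_oddPart_fst (hψ : ContDiff ℝ 2 (Function.uncurry ψ)) (t x : ℝ) :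
    deriv (fun τ => oddPart ψ τ x) t
      = (deriv (fun τ => ψ τ x) t + deriv (fun τ => ψ τ x) (-t)) / 2 := by
  have hf := differentiable_slice_fst hψ x
  have hg := differentiable_slice_fst_reflect hψ x
  show deriv (fun τ => (ψ τ x - ψ (-τ) x) / 2) t = _
  rw [deriv_div_const, deriv_fun_sub (hf t) (hg t), deriv_comp_neg (fun τ => ψ τ x) t]
  ring

theorem deriv_evenPart_snd (hψ : ContDiff ℝ 2 (Function.uncurry ψ)) (t x : ℝ) :
    deriv (evenPart ψ t) x = (deriv (ψ t) x + deriv (ψ (-t)) x) / 2 := by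
  have hf := differentiable_slice_snd hψ t
  have hg := differentiable_slice_snd hψ (-t)
  show deriv (fun y => (ψ t y + ψ (-t) y) / 2) x = _
  rw [deriv_div_const, deriv_fun_add (hf x) (hg x)]

theorem deriv_oddPart_snd (hψ : ContDiff ℝ 2 (Function.uncurry ψ)) (t x : ℝ) :
    deriv (oddPart ψ t) x = (deriv (ψ t) x - deriv (ψ (-t)) x) / 2 := by
  have hf := differentiable_slice_snd hψ t
  have hg := differentiable_slice_snd hψ (-t)
  show deriv (fun y => (ψ t y - ψ (-t) y) / 2) x = _
  rw [deriv_div_const, deriv_fun_sub (hf x) (hg x)]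

/-- **Pointwise parity split of the energy density** (parallelogram law). -/
theorem energyDensity_parity_split (hψ : ContDiff ℝ 2 (Function.uncurry ψ)) (V : ℝ → ℝ)
    (t x : ℝ) :
    energyDensity V ψ t x + energyDensity V ψ (-t) x
      = 2 * energyDensity V (evenPart ψ) t x + 2 * energyDensity V (oddPart ψ) t x := by
  simp only [energyDensity, deriv_evenPart_fst hψ, deriv_oddPart_fst hψ, deriv_evenPart_snd hψ,
    deriv_oddPart_snd hψ]
  simp only [evenPart, oddPart]
  ring

/-- At `t = 0` the energy splits: `e[ψ] = e[ψ_e] + e[ψ_o]`. -/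
theorem energyDensity_zero_split (hψ : ContDiff ℝ 2 (Function.uncurry ψ)) (V : ℝ → ℝ) (x : ℝ) :
    energyDensity V ψ 0 x = energyDensity V (evenPart ψ) 0 x + energyDensity V (oddPart ψ) 0 x := by
  have h := energyDensity_parity_split hψ V 0 x
  rw [neg_zero] at h
  linarith

/-- The energy density of a `C²` function along a continuous potential is continuous in `x`. -/
theorem continuous_energyDensity_slice {V : ℝ → ℝ} (hV : Continuous V)
    (hψ : ContDiff ℝ 2 (Function.uncurry ψ)) (t : ℝ) :
    Continuous fun x => energyDensity V ψ t x := by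
  have hp : Continuous fun x : ℝ => ((t, x) : ℝ × ℝ) := continuous_const.prodMk continuous_id
  have h1 : Continuous fun x => fderiv ℝ (Function.uncurry ψ) (t, x) (1, 0) :=
    (WaveEnergy.continuous_fderiv_apply hψ (1, 0)).comp hp
  have h2 : Continuous fun x => fderiv ℝ (Function.uncurry ψ) (t, x) (0, 1) :=
    (WaveEnergy.continuous_fderiv_apply hψ (0, 1)).comp hp
  have h3 : Continuous fun x => ψ t x := hψ.continuous.comp hp
  have heq : (fun x => energyDensity V ψ t x) = fun x =>
      (fderiv ℝ (Function.uncurry ψ) (t, x) (1, 0)) ^ 2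
        + (fderiv ℝ (Function.uncurry ψ) (t, x) (0, 1)) ^ 2 + V x * ψ t x ^ 2 := by
    funext x
    simp only [energyDensity, WaveEnergy.deriv_slice_fst_eq hψ, WaveEnergy.deriv_slice_snd_eq hψ]
  rw [heq]
  exact ((h1.pow 2).add (h2.pow 2)).add (hV.mul (h3.pow 2))

theorem measurable_ofReal_energyDensity {V : ℝ → ℝ} (hV : Continuous V)
    (hψ : ContDiff ℝ 2 (Function.uncurry ψ)) (t : ℝ) :
    Measurable fun x => ENNReal.ofReal (energyDensity V ψ t x) :=
  ENNReal.measurable_ofReal.comp (continuous_energyDensity_slice hV hψ t).measurable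

/-- **The parity split identity holds** (first lemma of the card, PROVED). -/
theorem paritySplitIdentity_holds : ParitySplitIdentity := by
  intro V hVc hV0 xc ρ ψ hψ t
  have hψe := contDiff_uncurry_evenPart hψ
  have hψo := contDiff_uncurry_oddPart hψ
  unfold exteriorEnergy
  have hset : {x : ℝ | ρ + |(-t)| < |x - xc|} = {x : ℝ | ρ + |t| < |x - xc|} := by
    ext x; simp [abs_neg]
  rw [hset]
  rw [← lintegral_add_left (measurable_ofReal_energyDensity hVc hψ t)]
  rw [← lintegral_const_mul' _ _ (by simp), ← lintegral_const_mul' _ _ (by simp)]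
  rw [← lintegral_add_left ((measurable_ofReal_energyDensity hVc hψe t).const_mul 2)]
  refine lintegral_congr fun x => ?_
  have hne : 0 ≤ energyDensity V ψ t x := energyDensity_nonneg _ _ (hV0 x)
  have hnn : 0 ≤ energyDensity V ψ (-t) x := energyDensity_nonneg _ _ (hV0 x)
  have hee : 0 ≤ energyDensity V (evenPart ψ) t x := energyDensity_nonneg _ _ (hV0 x)
  have hoo : 0 ≤ energyDensity V (oddPart ψ) t x := energyDensity_nonneg _ _ (hV0 x)
  rw [← ENNReal.ofReal_add hne hnn, energyDensity_parity_split hψ V t x,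
    ENNReal.ofReal_add (by positivity) (by positivity),
    ENNReal.ofReal_mul (by norm_num : (0:ℝ) ≤ 2), ENNReal.ofReal_mul (by norm_num : (0:ℝ) ≤ 2)]
  simp

end ParityCalculus


/-! ## Card `parity-split-standing-start`: the hard direction `W_even ∧ W_odd → W`, PROVED -/

section ParityHard

open Summit.FinalStateConjecture.FinalStateConjecture.Theorems

variable {V : ℝ → ℝ} {ψ : ℝ → ℝ → ℝ}

theorem contDiff_slice_fst_reflect (hψ : ContDiff ℝ 2 (Function.uncurry ψ)) (x : ℝ) :
    ContDiff ℝ 2 (fun τ => ψ (-τ) x) :=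
  (contDiff_slice_fst hψ x).comp contDiff_neg

theorem iteratedDeriv_evenPart_fst (hψ : ContDiff ℝ 2 (Function.uncurry ψ)) (t x : ℝ) :
    iteratedDeriv 2 (fun τ => evenPart ψ τ x) t
      = (iteratedDeriv 2 (fun τ => ψ τ x) t + iteratedDeriv 2 (fun τ => ψ τ x) (-t)) / 2 := by
  show iteratedDeriv 2 (fun τ => (ψ τ x + ψ (-τ) x) / 2) t = _
  rw [iteratedDeriv_div_const,
    iteratedDeriv_fun_add ((contDiff_slice_fst hψ x).contDiffAt)
      ((contDiff_slice_fst_reflect hψ x).contDiffAt),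
    iteratedDeriv_comp_neg 2 (fun τ => ψ τ x) t]
  simp

theorem iteratedDeriv_oddPart_fst (hψ : ContDiff ℝ 2 (Function.uncurry ψ)) (t x : ℝ) :
    iteratedDeriv 2 (fun τ => oddPart ψ τ x) t
      = (iteratedDeriv 2 (fun τ => ψ τ x) t - iteratedDeriv 2 (fun τ => ψ τ x) (-t)) / 2 := by
  show iteratedDeriv 2 (fun τ => (ψ τ x - ψ (-τ) x) / 2) t = _
  rw [iteratedDeriv_div_const,
    iteratedDeriv_fun_sub ((contDiff_slice_fst hψ x).contDiffAt)
      ((contDiff_slice_fst_reflect hψ x).contDiffAt),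
    iteratedDeriv_comp_neg 2 (fun τ => ψ τ x) t]
  simp

theorem iteratedDeriv_evenPart_snd (hψ : ContDiff ℝ 2 (Function.uncurry ψ)) (t x : ℝ) :
    iteratedDeriv 2 (evenPart ψ t) x = (iteratedDeriv 2 (ψ t) x + iteratedDeriv 2 (ψ (-t)) x) / 2 := by
  show iteratedDeriv 2 (fun y => (ψ t y + ψ (-t) y) / 2) x = _
  rw [iteratedDeriv_div_const,
    iteratedDeriv_fun_add ((contDiff_slice_snd hψ t).contDiffAt)
      ((contDiff_slice_snd hψ (-t)).contDiffAt)]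

theorem iteratedDeriv_oddPart_snd (hψ : ContDiff ℝ 2 (Function.uncurry ψ)) (t x : ℝ) :
    iteratedDeriv 2 (oddPart ψ t) x = (iteratedDeriv 2 (ψ t) x - iteratedDeriv 2 (ψ (-t)) x) / 2 := by
  show iteratedDeriv 2 (fun y => (ψ t y - ψ (-t) y) / 2) x = _
  rw [iteratedDeriv_div_const,
    iteratedDeriv_fun_sub ((contDiff_slice_snd hψ t).contDiffAt)
      ((contDiff_slice_snd hψ (-t)).contDiffAt)]

/-- The even part of a solution is a solution (data `(ψ₀, 0)`). -/
theorem isSolution_evenPart (hψ : IsSolution V ψ) : IsSolution V (evenPart ψ) := by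
  refine ⟨contDiff_uncurry_evenPart hψ.1, fun z => ?_⟩
  obtain ⟨t, x⟩ := z
  have h1 := hψ.2 (t, x)
  have h2 := hψ.2 (-t, x)
  unfold IsSolutionAt at h1 h2 ⊢
  simp only at h1 h2 ⊢
  rw [iteratedDeriv_evenPart_fst hψ.1, iteratedDeriv_evenPart_snd hψ.1]
  simp only [evenPart]
  linear_combination (h1 + h2) / 2

/-- The odd part of a solution is a solution (data `(0, ψ₁)`). -/
theorem isSolution_oddPart (hψ : IsSolution V ψ) : IsSolution V (oddPart ψ) := by
  refine ⟨contDiff_uncurry_oddPart hψ.1, fun z => ?_⟩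
  obtain ⟨t, x⟩ := z
  have h1 := hψ.2 (t, x)
  have h2 := hψ.2 (-t, x)
  unfold IsSolutionAt at h1 h2 ⊢
  simp only at h1 h2 ⊢
  rw [iteratedDeriv_oddPart_fst hψ.1, iteratedDeriv_oddPart_snd hψ.1]
  simp only [oddPart]
  linear_combination (h1 - h2) / 2

theorem supported_evenPart (hψ : ContDiff ℝ 2 (Function.uncurry ψ)) {S : Set ℝ}
    (hsupp : CauchyDataSupportedOn ψ S) : CauchyDataSupportedOn (evenPart ψ) S := by
  intro x hx
  obtain ⟨h0, -⟩ := hsupp x hx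
  refine ⟨by simp [evenPart, h0], ?_⟩
  rw [deriv_evenPart_fst hψ 0 x]
  simp

theorem supported_oddPart (hψ : ContDiff ℝ 2 (Function.uncurry ψ)) {S : Set ℝ}
    (hsupp : CauchyDataSupportedOn ψ S) : CauchyDataSupportedOn (oddPart ψ) S := by
  intro x hx
  obtain ⟨-, h1⟩ := hsupp x hx
  refine ⟨by simp [oddPart], ?_⟩
  rw [deriv_oddPart_fst hψ 0 x]
  simp [h1]

/-- The energy splits at `t = 0`: `E(ψ) = E(ψ_e) + E(ψ_o)`. -/
theorem totalEnergy_zero_split (hVc : Continuous V) (hV0 : ∀ x, 0 ≤ V x)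
    (hψ : ContDiff ℝ 2 (Function.uncurry ψ)) :
    totalEnergy V ψ 0 = totalEnergy V (evenPart ψ) 0 + totalEnergy V (oddPart ψ) 0 := by
  unfold totalEnergy
  rw [← lintegral_add_left (measurable_ofReal_energyDensity hVc (contDiff_uncurry_evenPart hψ) 0)]
  refine lintegral_congr fun x => ?_
  rw [energyDensity_zero_split hψ V x,
    ENNReal.ofReal_add (energyDensity_nonneg _ _ (hV0 x)) (energyDensity_nonneg _ _ (hV0 x))]

/-! ### Time shift and time reflection; convergence of exterior energies for EVERY aperture -/

/-- Time shift `ψ(· + c, ·)`. -/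
def tshift (ψ : ℝ → ℝ → ℝ) (c : ℝ) : ℝ → ℝ → ℝ := fun t x => ψ (t + c) x

/-- Time reflection `ψ(−·, ·)`. -/
def treflect (ψ : ℝ → ℝ → ℝ) : ℝ → ℝ → ℝ := fun t x => ψ (-t) x

theorem isSolution_tshift (hψ : IsSolution V ψ) (c : ℝ) : IsSolution V (tshift ψ c) := by
  refine ⟨hψ.1.comp ((contDiff_fst.add contDiff_const).prodMk contDiff_snd), fun z => ?_⟩
  have h := hψ.2 (z.1 + c, z.2)
  unfold IsSolutionAt at h ⊢
  have h1 : iteratedDeriv 2 (fun τ => tshift ψ c τ z.2) z.1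
      = iteratedDeriv 2 (fun τ => ψ τ z.2) (z.1 + c) := by
    show iteratedDeriv 2 (fun τ => ψ (τ + c) z.2) z.1 = _
    rw [iteratedDeriv_comp_add_const 2 (fun τ => ψ τ z.2) c]
  rw [h1]
  exact h

theorem isSolution_treflect (hψ : IsSolution V ψ) : IsSolution V (treflect ψ) := by
  refine ⟨contDiff_uncurry_reflect hψ.1, fun z => ?_⟩
  have h := hψ.2 (-z.1, z.2)
  unfold IsSolutionAt at h ⊢
  have h1 : iteratedDeriv 2 (fun τ => treflect ψ τ z.2) z.1
      = iteratedDeriv 2 (fun τ => ψ τ z.2) (-z.1) := by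
    show iteratedDeriv 2 (fun τ => ψ (-τ) z.2) z.1 = _
    rw [iteratedDeriv_comp_neg 2 (fun τ => ψ τ z.2) z.1]
    simp
  rw [h1]
  exact h

theorem energyDensity_tshift (V : ℝ → ℝ) (ψ : ℝ → ℝ → ℝ) (c t x : ℝ) :
    energyDensity V (tshift ψ c) t x = energyDensity V ψ (t + c) x := by
  unfold energyDensity tshift
  rw [deriv_comp_add_const (fun τ => ψ τ x) c t]

theorem energyDensity_treflect (V : ℝ → ℝ) (ψ : ℝ → ℝ → ℝ) (t x : ℝ) :
    energyDensity V (treflect ψ) t x = energyDensity V ψ (-t) x := by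
  unfold energyDensity treflect
  rw [deriv_comp_neg (fun τ => ψ τ x) t]
  ring

theorem exteriorEnergy_treflect (V : ℝ → ℝ) (xc a : ℝ) (ψ : ℝ → ℝ → ℝ) (t : ℝ) :
    exteriorEnergy V xc a (treflect ψ) t = exteriorEnergy V xc a ψ (-t) := by
  unfold exteriorEnergy
  have hset : {x : ℝ | a + |(-t)| < |x - xc|} = {x : ℝ | a + |t| < |x - xc|} := by
    ext x; simp [abs_neg]
  rw [hset]
  exact lintegral_congr fun x => by rw [energyDensity_treflect]

/-- For `t ≥ 0` with `t + a ≥ 0`, the exterior energy of aperture `a` at time `t` is the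
exterior energy of aperture `0` at time `t + a` of the time-shifted solution. -/
theorem exteriorEnergy_eq_tshift (V : ℝ → ℝ) (xc : ℝ) {a t : ℝ} (ht : 0 ≤ t) (hta : 0 ≤ t + a)
    (ψ : ℝ → ℝ → ℝ) :
    exteriorEnergy V xc a ψ t = exteriorEnergy V xc 0 (tshift ψ (-a)) (t + a) := by
  unfold exteriorEnergy
  have hset : {x : ℝ | a + |t| < |x - xc|} = {x : ℝ | 0 + |t + a| < |x - xc|} := by
    ext x
    simp only [mem_setOf_eq]
    rw [abs_of_nonneg ht, abs_of_nonneg hta]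
    constructor <;> intro h <;> linarith
  rw [hset]
  refine lintegral_congr fun x => ?_
  rw [energyDensity_tshift]
  simp

/-- Exterior energies of a solution are non-increasing on `t ≥ max 0 (−a)` for EVERY aperture `a`
(negative, i.e. lagged, apertures included). -/
theorem exteriorEnergy_antitoneOn_tail (hV : Differentiable ℝ V) (hV0 : ∀ x, 0 ≤ V x)
    (hψ : IsSolution V ψ) (xc a : ℝ) :
    AntitoneOn (exteriorEnergy V xc a ψ) (Ici (max 0 (-a))) := by
  intro t₁ ht₁ t₂ ht₂ h12
  simp only [mem_Ici, max_le_iff] at ht₁ ht₂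
  rw [exteriorEnergy_eq_tshift V xc ht₁.1 (by linarith) ψ,
    exteriorEnergy_eq_tshift V xc ht₂.1 (by linarith) ψ]
  exact (RW.exteriorEnergy_antitoneOn hV hV0 (isSolution_tshift hψ (-a)) xc le_rfl).1
    (by simp only [mem_Ici]; linarith) (by simp only [mem_Ici]; linarith) (by linarith)

/-- **Convergence forward**: the exterior energy tends to the forward channel energy. -/
theorem tendsto_exteriorEnergy_atTop (hV : Differentiable ℝ V) (hV0 : ∀ x, 0 ≤ V x)
    (hψ : IsSolution V ψ) (xc a : ℝ) :
    Tendsto (exteriorEnergy V xc a ψ) atTop (𝓝 (channelEnergy V xc a ψ atTop)) := by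
  set T₀ : ℝ := max 0 (-a) with hT₀
  have hanti := exteriorEnergy_antitoneOn_tail hV hV0 hψ xc a
  set g : ℝ → ℝ≥0∞ := fun t => exteriorEnergy V xc a ψ (max t T₀) with hg_def
  have hg : Antitone g := by
    intro t t' htt'
    exact hanti (Set.mem_Ici.2 (le_max_right t T₀)) (Set.mem_Ici.2 (le_max_right t' T₀))
      (max_le_max htt' le_rfl)
  have hlim : Tendsto g atTop (𝓝 (⨅ t, g t)) := tendsto_atTop_iInf hg
  have heq : g =ᶠ[atTop] exteriorEnergy V xc a ψ := by
    filter_upwards [eventually_ge_atTop T₀] with t ht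
    simp [hg_def, max_eq_left ht]
  have hlimE : Tendsto (exteriorEnergy V xc a ψ) atTop (𝓝 (⨅ t, g t)) := hlim.congr' heq
  have hch : channelEnergy V xc a ψ atTop = ⨅ t, g t := hlimE.liminf_eq
  rw [hch]
  exact hlimE

/-- **Convergence backward**: the exterior energy tends to the backward channel energy. -/
theorem tendsto_exteriorEnergy_atBot (hV : Differentiable ℝ V) (hV0 : ∀ x, 0 ≤ V x)
    (hψ : IsSolution V ψ) (xc a : ℝ) :
    Tendsto (exteriorEnergy V xc a ψ) atBot (𝓝 (channelEnergy V xc a ψ atBot)) := by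
  have h := tendsto_exteriorEnergy_atTop hV hV0 (isSolution_treflect hψ) xc a
  have hfun : exteriorEnergy V xc a ψ = (exteriorEnergy V xc a (treflect ψ)) ∘ Neg.neg := by
    funext t
    simp only [Function.comp_apply]
    rw [exteriorEnergy_treflect]
    simp
  have hch : channelEnergy V xc a ψ atBot = channelEnergy V xc a (treflect ψ) atTop := by
    unfold channelEnergy
    rw [hfun, Filter.liminf_comp, Filter.map_neg_atBot]
  rw [hch, hfun]
  exact h.comp tendsto_neg_atBot_atTop

/-- **Channel form of the parity split**: `ch⁺(ψ) + ch⁻(ψ) = 2 ch⁺(ψ_e) + 2 ch⁺(ψ_o)` for every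
aperture. -/
theorem channel_parity_split (hVc : Continuous V) (hV : Differentiable ℝ V) (hV0 : ∀ x, 0 ≤ V x)
    (hψ : IsSolution V ψ) (xc a : ℝ) :
    channelEnergy V xc a ψ atTop + channelEnergy V xc a ψ atBot
      = 2 * channelEnergy V xc a (evenPart ψ) atTop + 2 * channelEnergy V xc a (oddPart ψ) atTop := by
  have h1 := tendsto_exteriorEnergy_atTop hV hV0 hψ xc a
  have h2 := (tendsto_exteriorEnergy_atBot hV hV0 hψ xc a).comp tendsto_neg_atTop_atBot
  have hL : Tendsto (fun t => exteriorEnergy V xc a ψ t + exteriorEnergy V xc a ψ (-t)) atTop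
      (𝓝 (channelEnergy V xc a ψ atTop + channelEnergy V xc a ψ atBot)) := h1.add h2
  have he := tendsto_exteriorEnergy_atTop hV hV0 (isSolution_evenPart hψ) xc a
  have ho := tendsto_exteriorEnergy_atTop hV hV0 (isSolution_oddPart hψ) xc a
  have hR : Tendsto (fun t => 2 * exteriorEnergy V xc a (evenPart ψ) t
      + 2 * exteriorEnergy V xc a (oddPart ψ) t) atTop
      (𝓝 (2 * channelEnergy V xc a (evenPart ψ) atTop
        + 2 * channelEnergy V xc a (oddPart ψ) atTop)) :=
    (ENNReal.Tendsto.const_mul he (Or.inr (by simp))).add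
      (ENNReal.Tendsto.const_mul ho (Or.inr (by simp)))
  have hfun : (fun t => exteriorEnergy V xc a ψ t + exteriorEnergy V xc a ψ (-t))
      = fun t => 2 * exteriorEnergy V xc a (evenPart ψ) t + 2 * exteriorEnergy V xc a (oddPart ψ) t :=
    funext fun t => paritySplitIdentity_holds V hVc hV0 xc a ψ hψ.1 t
  rw [hfun] at hL
  exact tendsto_nhds_unique hL hR

/-- Monotonicity of channel energies in the aperture. -/
theorem channelEnergy_mono_aperture (V : ℝ → ℝ) (xc : ℝ) {ρ ρ' : ℝ} (hρ : ρ' ≤ ρ)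
    (ψ : ℝ → ℝ → ℝ) (l : Filter ℝ) :
    channelEnergy V xc ρ ψ l ≤ channelEnergy V xc ρ' ψ l :=
  Filter.liminf_le_liminf (Eventually.of_forall fun t => exteriorEnergy_mono_aperture V xc ρ ρ' ψ t hρ)

/-- **`W_even ∧ W_odd → W`** (the hard direction of `ParityTransfer`), PROVED. -/
theorem parityTransfer_mpr (he : WindowedShellChannelsEven) (ho : WindowedShellChannelsOdd) :
    WindowedShellChannels := by
  intro M hM ρ hρ
  obtain ⟨h₁, hh₁, c₁, hc₁, H₁⟩ := he M hM ρ hρ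
  obtain ⟨h₂, hh₂, c₂, hc₂, H₂⟩ := ho M hM ρ hρ
  refine ⟨max h₁ h₂, le_trans hh₁ (le_max_left _ _), 2 * min c₁ c₂, by positivity, ?_⟩
  intro r xc hr s ℓ hs hsℓ ψ hψ hsupp
  set V := linePotential M s ℓ r with hVdef
  have hV : Differentiable ℝ V := RW.differentiable_linePotential hr s ℓ
  have hV0 : ∀ x, 0 ≤ V x := fun x => (RW.linePotential_pos hr hsℓ x).le
  have hVc : Continuous V := hV.continuous
  have hψe : IsRWSolution M s ℓ r (evenPart ψ) := isSolution_evenPart hψ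
  have hψo : IsRWSolution M s ℓ r (oddPart ψ) := isSolution_oddPart hψ
  have hse := supported_evenPart hψ.1 hsupp
  have hso := supported_oddPart hψ.1 hsupp
  have heven : ∀ t x, evenPart ψ (-t) x = evenPart ψ t x := by
    intro t x; simp only [evenPart, neg_neg]; ring
  have hodd : ∀ t x, oddPart ψ (-t) x = -oddPart ψ t x := by
    intro t x; simp only [oddPart, neg_neg]; ring
  have hρ₁ : ρ - max h₁ h₂ ≤ ρ - h₁ := by linarith [le_max_left h₁ h₂]
  have hρ₂ : ρ - max h₁ h₂ ≤ ρ - h₂ := by linarith [le_max_right h₁ h₂]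
  have K₁ := (H₁ r xc hr s ℓ hs hsℓ (evenPart ψ) hψe heven hse).trans
    (channelEnergy_mono_aperture V xc hρ₁ (evenPart ψ) atTop)
  have K₂ := (H₂ r xc hr s ℓ hs hsℓ (oddPart ψ) hψo hodd hso).trans
    (channelEnergy_mono_aperture V xc hρ₂ (oddPart ψ) atTop)
  have hsplit := channel_parity_split hVc hV hV0 hψ xc (ρ - max h₁ h₂)
  have hE := totalEnergy_zero_split hVc hV0 hψ.1
  rw [hsplit, hE]
  have hc1 : ENNReal.ofReal (min c₁ c₂) ≤ ENNReal.ofReal c₁ := ENNReal.ofReal_le_ofReal (min_le_left _ _)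
  have hc2 : ENNReal.ofReal (min c₁ c₂) ≤ ENNReal.ofReal c₂ := ENNReal.ofReal_le_ofReal (min_le_right _ _)
  have h2m : ENNReal.ofReal (2 * min c₁ c₂) = 2 * ENNReal.ofReal (min c₁ c₂) := by
    rw [ENNReal.ofReal_mul (by norm_num : (0:ℝ) ≤ 2)]; simp
  rw [h2m]
  calc 2 * ENNReal.ofReal (min c₁ c₂) * (totalEnergy V (evenPart ψ) 0 + totalEnergy V (oddPart ψ) 0)
      = 2 * (ENNReal.ofReal (min c₁ c₂) * totalEnergy V (evenPart ψ) 0)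
        + 2 * (ENNReal.ofReal (min c₁ c₂) * totalEnergy V (oddPart ψ) 0) := by ring
    _ ≤ 2 * (ENNReal.ofReal c₁ * totalEnergy V (evenPart ψ) 0)
        + 2 * (ENNReal.ofReal c₂ * totalEnergy V (oddPart ψ) 0) := by gcongr
    _ ≤ 2 * channelEnergy V xc (ρ - max h₁ h₂) (evenPart ψ) atTop
        + 2 * channelEnergy V xc (ρ - max h₁ h₂) (oddPart ψ) atTop := by gcongr

/-- **The transfer is an EQUIVALENCE** (card `parity-split-standing-start`), PROVED. -/
theorem parityTransfer_holds : ParityTransfer :=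
  ⟨parityTransfer_mp, fun h => parityTransfer_mpr h.1 h.2⟩

end ParityHard


/-! ## Card `outward-completion-duality`: the abstract reduction (PROVED) and the concrete target -/

section CompletionDuality

open scoped InnerProductSpace
open ContinuousLinearMap

variable {E : Type*} [NormedAddCommGroup E] [InnerProductSpace ℝ E] [CompleteSpace E]

theorem inner_nonneg_of_isPositive {P : E →L[ℝ] E} (hP : P.IsPositive) (a : E) :
    0 ≤ ⟪P a, a⟫_ℝ := by
  have h := hP.inner_nonneg_left a
  simpa using h

theorem inner_symm_of_isPositive {P : E →L[ℝ] E} (hP : P.IsPositive) (a b : E) :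
    ⟪P a, b⟫_ℝ = ⟪P b, a⟫_ℝ := by
  have hsa : IsSelfAdjoint P := hP.isSelfAdjoint
  have h1 : ⟪P a, b⟫_ℝ = ⟪a, P b⟫_ℝ := by
    rw [← ContinuousLinearMap.adjoint_inner_left, hsa.adjoint_eq]
  rw [h1, real_inner_comm]

/-- Cauchy–Schwarz for the positive form `⟪P z, w⟫` of a positive operator. -/
theorem inner_map_sq_le {P : E →L[ℝ] E} (hP : P.IsPositive) (z w : E) :
    ⟪P z, w⟫_ℝ ^ 2 ≤ ⟪P z, z⟫_ℝ * ⟪P w, w⟫_ℝ := by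
  have hsym := inner_symm_of_isPositive hP
  have hnn := inner_nonneg_of_isPositive hP
  have hq : ∀ t : ℝ, 0 ≤ ⟪P z, z⟫_ℝ - 2 * t * ⟪P z, w⟫_ℝ + t ^ 2 * ⟪P w, w⟫_ℝ := by
    intro t
    have h := hnn (z - t • w)
    have hexp : ⟪P (z - t • w), z - t • w⟫_ℝ
        = ⟪P z, z⟫_ℝ - 2 * t * ⟪P z, w⟫_ℝ + t ^ 2 * ⟪P w, w⟫_ℝ := by
      simp only [map_sub, map_smul, inner_sub_left, inner_sub_right, real_inner_smul_left,
        real_inner_smul_right]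
      rw [hsym w z]
      ring
    rw [hexp] at h
    exact h
  set a := ⟪P w, w⟫_ℝ with ha
  set b := ⟪P z, w⟫_ℝ with hb
  set c := ⟪P z, z⟫_ℝ with hc
  have ha0 : 0 ≤ a := hnn w
  rcases ha0.lt_or_eq with hapos | hazero
  · have h := hq (b / a)
    have : c - 2 * (b / a) * b + (b / a) ^ 2 * a = c - b ^ 2 / a := by
      field_simp
      ring
    rw [this] at h
    have h' : b ^ 2 / a ≤ c := by linarith
    rw [div_le_iff₀ hapos] at h'
    linarith [h']
  · have hbz : b = 0 := by
      by_contra hbne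
      have h := hq ((c + 1) / (2 * b))
      rw [← hazero] at h
      have : c - 2 * ((c + 1) / (2 * b)) * b + ((c + 1) / (2 * b)) ^ 2 * 0 = -1 := by
        field_simp
        ring
      rw [this] at h
      linarith
    rw [hbz, ← hazero]
    simp

/-- For a positive contraction `Q` (`0 ≤ Q` and `0 ≤ 1 − Q`): `‖Q z‖² ≤ ⟪Q z, z⟫`. -/
theorem norm_sq_le_inner_of_contraction {Q : E →L[ℝ] E} (hQ : Q.IsPositive)
    (hQ1 : (1 - Q).IsPositive) (z : E) : ‖Q z‖ ^ 2 ≤ ⟪Q z, z⟫_ℝ := by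
  have h1 := inner_map_sq_le hQ z (Q z)
  have h2 : ⟪Q (Q z), Q z⟫_ℝ ≤ ⟪Q z, Q z⟫_ℝ := by
    have h' := inner_nonneg_of_isPositive hQ1 (Q z)
    rw [ContinuousLinearMap.sub_apply, inner_sub_left, ContinuousLinearMap.one_apply] at h'
    linarith
  have hzz : ⟪Q z, Q z⟫_ℝ = ‖Q z‖ ^ 2 := real_inner_self_eq_norm_sq (Q z)
  rw [hzz] at h1 h2
  have hnn : 0 ≤ ⟪Q z, z⟫_ℝ := inner_nonneg_of_isPositive hQ z
  by_cases hz : ‖Q z‖ ^ 2 = 0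
  · rw [hz]; exact hnn
  · have hpos : 0 < ‖Q z‖ ^ 2 := lt_of_le_of_ne (by positivity) (Ne.symm hz)
    have h3 : (‖Q z‖ ^ 2) ^ 2 ≤ ⟪Q z, z⟫_ℝ * ‖Q z‖ ^ 2 :=
      h1.trans (mul_le_mul_of_nonneg_left h2 hnn)
    nlinarith

/-- **Completion duality** (the reduction behind the card `outward-completion-duality`).
`K` positive contraction (`caught`), `J` linear isometry (parity-pure off-shell data), `C` a
completion of `J` (`J† ∘ C = id`) whose images are `θ`-nearly caught (`lost ≤ θ²`): then the
caught form is coercive on `range J` with constant `(1 − θ)² / ‖C‖²`. -/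
theorem completion_duality {X : Type*} [NormedAddCommGroup X] [InnerProductSpace ℝ X]
    [CompleteSpace X] (K : E →L[ℝ] E) (hK : K.IsPositive) (hK1 : (1 - K).IsPositive)
    (J : X →ₗᵢ[ℝ] E) (C : X →L[ℝ] E)
    (hJC : ∀ x : X, (J.toContinuousLinearMap).adjoint (C x) = x)
    {θ : ℝ} (hθ0 : 0 ≤ θ) (hθ1 : θ ≤ 1)
    (hlost : ∀ x : X, ⟪(1 - K) (C x), C x⟫_ℝ ≤ θ ^ 2 * ‖x‖ ^ 2) (x : X) :
    (1 - θ) ^ 2 * ‖x‖ ^ 2 ≤ ‖C‖ ^ 2 * ⟪K (J x), J x⟫_ℝ := by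
  set Jc := J.toContinuousLinearMap with hJc
  set y : X := Jc.adjoint (K (C x)) with hy
  -- (1) ‖x − y‖ ≤ θ ‖x‖
  have hxy : x - y = Jc.adjoint ((1 - K) (C x)) := by
    rw [hy, ContinuousLinearMap.sub_apply, map_sub, ContinuousLinearMap.one_apply, hJC x]
  have hK' : (1 - (1 - K)).IsPositive := by simpa using hK
  have hv : ‖(1 - K) (C x)‖ ≤ θ * ‖x‖ := by
    have h2 : ‖(1 - K) (C x)‖ ^ 2 ≤ (θ * ‖x‖) ^ 2 := by
      rw [mul_pow]
      exact (norm_sq_le_inner_of_contraction hK1 hK' (C x)).trans (hlost x)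
    exact (pow_le_pow_iff_left₀ (norm_nonneg _) (by positivity) two_ne_zero).1 h2
  have hnorm : ‖x - y‖ ≤ θ * ‖x‖ := by
    rw [hxy]
    calc ‖Jc.adjoint ((1 - K) (C x))‖ ≤ ‖Jc.adjoint‖ * ‖(1 - K) (C x)‖ := le_opNorm _ _
      _ = ‖Jc‖ * ‖(1 - K) (C x)‖ := by rw [ContinuousLinearMap.adjoint.norm_map]
      _ ≤ 1 * (θ * ‖x‖) := by
          gcongr
          exact J.norm_toContinuousLinearMap_le
      _ = θ * ‖x‖ := one_mul _
  -- (2) ⟪y, x⟫ ≥ (1 − θ) ‖x‖²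
  have hyx : (1 - θ) * ‖x‖ ^ 2 ≤ ⟪y, x⟫_ℝ := by
    have h1 : ⟪y, x⟫_ℝ = ⟪x, x⟫_ℝ - ⟪x - y, x⟫_ℝ := by rw [inner_sub_left]; ring
    have h2 : ⟪x - y, x⟫_ℝ ≤ ‖x - y‖ * ‖x‖ := real_inner_le_norm _ _
    have h3 : ⟪x, x⟫_ℝ = ‖x‖ ^ 2 := real_inner_self_eq_norm_sq x
    have h4 : ‖x - y‖ * ‖x‖ ≤ θ * ‖x‖ * ‖x‖ := mul_le_mul_of_nonneg_right hnorm (norm_nonneg _)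
    nlinarith
  -- (3) ⟪y, x⟫ = ⟪K (J x), C x⟫ and Cauchy–Schwarz for the K-form
  have hyx' : ⟪y, x⟫_ℝ = ⟪K (J x), C x⟫_ℝ := by
    rw [hy, ContinuousLinearMap.adjoint_inner_left]
    show ⟪K (C x), J x⟫_ℝ = ⟪K (J x), C x⟫_ℝ
    exact inner_symm_of_isPositive hK _ _
  have hCS := inner_map_sq_le hK (J x) (C x)
  have hKC : ⟪K (C x), C x⟫_ℝ ≤ ‖C‖ ^ 2 * ‖x‖ ^ 2 := by
    have h' := inner_nonneg_of_isPositive hK1 (C x)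
    rw [ContinuousLinearMap.sub_apply, inner_sub_left, ContinuousLinearMap.one_apply,
      real_inner_self_eq_norm_sq] at h'
    have hle : ⟪K (C x), C x⟫_ℝ ≤ ‖C x‖ ^ 2 := by linarith
    have hCx : ‖C x‖ ≤ ‖C‖ * ‖x‖ := le_opNorm _ _
    have : ‖C x‖ ^ 2 ≤ (‖C‖ * ‖x‖) ^ 2 := pow_le_pow_left₀ (norm_nonneg _) hCx 2
    nlinarith
  have hKJ : 0 ≤ ⟪K (J x), J x⟫_ℝ := inner_nonneg_of_isPositive hK _
  -- combine: ((1-θ)‖x‖²)² ≤ ⟪KJx,Jx⟫ · ‖C‖² ‖x‖²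
  have hpos : 0 ≤ 1 - θ := by linarith
  have key : ((1 - θ) * ‖x‖ ^ 2) ^ 2 ≤ ⟪K (J x), J x⟫_ℝ * (‖C‖ ^ 2 * ‖x‖ ^ 2) := by
    have hsq : ((1 - θ) * ‖x‖ ^ 2) ^ 2 ≤ ⟪y, x⟫_ℝ ^ 2 :=
      pow_le_pow_left₀ (by positivity) hyx 2
    rw [hyx'] at hsq
    exact hsq.trans (hCS.trans (mul_le_mul_of_nonneg_left hKC hKJ))
  by_cases hx : ‖x‖ = 0
  · rw [hx]; simp; positivity
  · have hxpos : 0 < ‖x‖ ^ 2 := by positivity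
    have key' : ((1 - θ) ^ 2 * ‖x‖ ^ 2) * ‖x‖ ^ 2 ≤ (‖C‖ ^ 2 * ⟪K (J x), J x⟫_ℝ) * ‖x‖ ^ 2 := by
      have e1 : ((1 - θ) * ‖x‖ ^ 2) ^ 2 = ((1 - θ) ^ 2 * ‖x‖ ^ 2) * ‖x‖ ^ 2 := by ring
      have e2 : ⟪K (J x), J x⟫_ℝ * (‖C‖ ^ 2 * ‖x‖ ^ 2) = (‖C‖ ^ 2 * ⟪K (J x), J x⟫_ℝ) * ‖x‖ ^ 2 := by
        ring
      rw [← e1, ← e2]; exact key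
    exact le_of_mul_le_mul_right key' hxpos


end CompletionDuality

/-- Card `outward-completion-duality`, concrete analytic target (even parity): the OUTWARD
completion `ψ₁ := −sign(x − x_c)·ψ₀′` of an off-shell position profile radiates, ahead of the
lagged cones, all but `θ² < 1` of the POSITION energy `E(ψ₀, 0) = ∫ ψ₀′² + V ψ₀²` — stated as
`E(ψ) ≤ caught⁺ + θ²·E(ψ₀,0)` to stay inside `ℝ≥0∞`.  With `completion_duality`
(`K` = forward-caught form, `J ψ₀ = (ψ₀,0)`, `C ψ₀ = (ψ₀, −sign·ψ₀′)`, `‖C‖² ≤ 2`) it yields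
`WindowedShellChannelsEven` with `c = (1 − θ)²/2`; the odd analogue completes a kick `g` by the
order-(−1) outward position `σ·ω(x,D)⁻¹ g` and yields `WindowedShellChannelsOdd`; then
`parityTransfer_mpr`. -/
def OutwardDataEscapeEven : Prop :=
  ∀ M : ℝ, 0 < M → ∀ ρ : ℝ, 0 < ρ → ∃ h : ℝ, 0 ≤ h ∧ ∃ θ : ℝ, 0 ≤ θ ∧ θ < 1 ∧
    ∀ (r : ℝ → ℝ) (xc : ℝ), IsTortoiseRadius M r xc → ∀ (s ℓ : ℕ), s ≤ 2 → s ≤ ℓ →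
      ∀ ψ : ℝ → ℝ → ℝ, IsRWSolution M s ℓ r ψ →
        CauchyDataSupportedOn ψ {x : ℝ | ρ < |x - xc|} →
        (∀ x, deriv (fun τ => ψ τ x) 0 = -(Real.sign (x - xc)) * deriv (ψ 0) x) →
          totalEnergy (linePotential M s ℓ r) ψ 0 ≤
            channelEnergy (linePotential M s ℓ r) xc (ρ - h) ψ atTop +
              ENNReal.ofReal (θ ^ 2) *
                ∫⁻ x, ENNReal.ofReal (deriv (ψ 0) x ^ 2 + linePotential M s ℓ r x * ψ 0 x ^ 2)

end Summit.FinalStateConjecture.FinalStateConjecture.Cruxes.WindowedShellChannels.Ideator3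

end
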